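/-
Copyright (c) 2026. All rights reserved.
Released under Apache 2.0 license as described in the file LICENSE.
Authors: abc-iut cell, seat abc-iut-rh2-q2-cond (gen 7); §1's integer law adapted from the referee seat
abc-iut-rh3-ref-1's staging lemma `PrintContainerLemma.lean` (offered «free to land under any typer's name»).
-/
import Literature.IUT.LogVolume.UnitLogMaxNorm
import Literature.IUT.LogVolume.LogRadius
import HarnessLib

/-!
# The exact radius of `log_p(𝒪_K^×)` sits INSIDE print's container: `‖ϖ‖^{p^{a₀} − e·a₀} ≤ p^{b}`

Proof-only file (theorems, no definitions, no named fact) joining two landed files: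

* abc-iut-c312-3's `UnitLogMaxNorm.lean`: for `K/ℚ_p` with ramification index `e` and turning point `a₀`
  of `e` (`p^a·(p−1) < e` for `a < a₀`, `e ≤ p^{a₀}·(p−1)`), EVERY unit logarithm has
  `‖log_p u‖ ≤ ‖ϖ‖^{p^{a₀} − e·a₀}` (`LogEnvelope.norm_unitLog_le_zpow_envelope`), with equality attained off
  the cyclotomic indices — the EXACT outer radius `R_out = p^{a₀} − e·a₀ = min_a (p^a − e·a)` of the R-H /
  R-W tables (`Repair/RHCellSlackExactOrdersClosedForm`, D-0121 R33 (c));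
* abc-iut-S1's `LogRadius.lean`: [IUTchIV] Prop. 1.2 (i) as printed, `log_p(R^×) ⊆ p^{−b}·R` with
  `b = logRadiusB p e = ⌊log(p·e/(p−1))/log p⌋ − 1/e` (`Prop12i`, `prop12i_holds`), whose proof isolates the
  floor `c := ⌊log(p·e/(p−1))/log p⌋` and its defining inequality `e < p^c·(p−1)` (`lt_pow_floor_mul`).

`UnitLogMaxNorm`'s module doc records the comparison of the two radii as «a remark; not used»: in
`‖ϖ‖`-exponents print's container is `1 − e·c` against the exact `p^{a₀} − e·a₀`.  THIS file makes the
remark a theorem (the D-0121 radii-audit sentence «our certified log-shell ROOM never exceeds what print's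
container charges», R-H lead R35 (2) / R36 (b), referee abc-iut-rh3-ref-1 2026-08-27T03:09:31Z):

* §1 (integers only) `one_add_mul_le_pow_add_mul` — for ANY `p ≥ 2`, if `p·e < p^{c+1}·(p−1)` then
  `1 + a·e ≤ p^a + c·e` for EVERY `a` (so `min_a (p^a − a·e) ≥ 1 − c·e`; abc-iut-rh3-ref-1's lemma);
  `floorLog_maximal` — print's floor `c` satisfies that hypothesis (= `lt_pow_floor_mul` times `p`);
  `turning_le_floorLog` — `a₀ ≤ c` for every turning point; `floorLog_le_turning_of_lt` — `c ≤ a₀` when the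
  turning inequality is strict, so `c = a₀` OFF the cyclotomic indices (`floorLog_eq_turning_of_lt`) and the
  container exceeds the room by exactly `p^{a₀} − 1` levels (`envelope_sub_container_eq_of_lt`);
  `container_le_exponent` — `1 − c·e ≤ p^a − e·a` for EVERY `a` (in particular at `a₀`: print's container
  exponent never exceeds the exact envelope exponent).
* §2 (norms) `zpow_envelope_le_rpow_logRadiusB` — `‖ϖ‖^{p^{a} − e·a} ≤ p^{logRadiusB p e}` for every `a`;
  `closedBall_envelope_subset_pBall` — the exact ball `{‖z‖ ≤ ‖ϖ‖^{p^{a₀} − e·a₀}}` lies in print's container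
  `p^{−b}·R = pBall p K (−logRadiusB p e)`; `logUnits_subset_pBall_of_turning` — hence
  `log_p(𝒪_K^×) ⊆` exact ball `⊆ p^{−b}·R`: the upper half of `Prop12i` re-derived THROUGH the exact radius
  (the turning-point-free form is a regression `example` whose statement is abc-iut-S1's landed
  `logUnits_subset_pBall_neg_logRadiusB`, not re-declared); `norm_unitLog_le_rpow_logRadiusB` —
  `‖log_p u‖ ≤ p^{b}` for every `u`, through the envelope.
* §3 the three worked places of the R-H bed (abc-iut-rh3-ref-1 03:06:59Z / 03:09:31Z): `p = 5, e = 6420`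
  (`a₀ = c = 5`: `−28975 ≥ −32099`), `p = 3, e = 3210` (`7`: `−20283 ≥ −22469`), `p = 7, e = 1605`
  (`3`: `−4472 ≥ −4814`), by `decide`.

Classical and undisputed arithmetic (Neukirch ANT II (5.5); Koblitz GTM 58 IV §1); the citation of
[IUTchIV] Prop. 1.2 records only that the CONTAINER exponent `b` is the printed one.  Nothing here asserts
any IUT statement or bears on [IUTchIII] Cor. 3.12 or on abc; typed ≠ proved for anything not a theorem here.
-/

noncomputable section

open Metric Set

namespace Literature.IUT.LogVolume

namespace LogEnvelope

open RamificationCriterion Literature.NumberTheory.GaloisRepresentations.Ultrametric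

/-! ### §1. Integers: `1 − c·e ≤ p^a − e·a` for every `a`, and `a₀ ≤ c` -/

section Arith

/-- Auxiliary: `k + 1 ≤ p^k` for `p ≥ 2`. [cite: NeukirchANT1999, Ch. II (5.5)] -/
theorem succ_le_pow_of_two_le {p : ℕ} (hp : 2 ≤ p) (k : ℕ) : k + 1 ≤ p ^ k := by
  induction k with
  | zero => simp
  | succ n ih =>
    rw [pow_succ]
    nlinarith [ih, hp, Nat.zero_le n]

/-- **ROOM INSIDE CONTAINER (integer law; abc-iut-rh3-ref-1).** For `p ≥ 2`: if `c` is maximal with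
`p^c·(p−1) ≤ p·e` — only the maximality `p·e < p^{c+1}·(p−1)` is used — then for EVERY exponent `a`,
`1 + a·e ≤ p^a + c·e`, i.e. `p^a − a·e ≥ 1 − c·e`; hence `min_a (p^a − a·e) ≥ 1 − c·e`.
(Adapted from `run/shared/lean/pub/abc-iut/abc-iut-rh3-ref-1/PrintContainerLemma.lean`.)
[cite: NeukirchANT1999, Ch. II (5.5)] -/
theorem one_add_mul_le_pow_add_mul {p : ℕ} (hp : 2 ≤ p) {e c : ℕ}
    (hc : p * e < p ^ (c + 1) * (p - 1)) (a : ℕ) : 1 + a * e ≤ p ^ a + c * e := by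
  rcases Nat.lt_or_ge c a with h | h
  swap
  · have h1 : 1 ≤ p ^ a := Nat.one_le_pow _ _ (by omega)
    have h2 : a * e ≤ c * e := Nat.mul_le_mul_right _ h
    omega
  · obtain ⟨k, rfl⟩ : ∃ k, a = c + 1 + k := ⟨a - (c + 1), by omega⟩
    have h1 : e + 1 ≤ p ^ (c + 1) := by
      by_contra hcon
      push Not at hcon
      have h3 : p ^ (c + 1) * (p - 1) ≤ e * (p - 1) := Nat.mul_le_mul_right _ (by omega)
      have h4 : e * (p - 1) ≤ e * p := Nat.mul_le_mul_left _ (Nat.sub_le _ _)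
      have h5 : e * p = p * e := Nat.mul_comm _ _
      omega
    have h2 : k + 1 ≤ p ^ k := succ_le_pow_of_two_le hp k
    have h3 : (e + 1) * (k + 1) ≤ p ^ (c + 1) * p ^ k := Nat.mul_le_mul h1 h2
    have h4 : p ^ (c + 1 + k) = p ^ (c + 1) * p ^ k := pow_add _ _ _
    have h5 : (c + 1 + k) * e = c * e + e + k * e := by ring
    have h6 : (e + 1) * (k + 1) = k * e + e + k + 1 := by ring
    rw [h4, h5]
    rw [h6] at h3
    omega

/-- Integer form of `one_add_mul_le_pow_add_mul` in the exponent shape of `UnitLogMaxNorm`: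
`1 − c·e ≤ p^a − e·a` for every `a`. [cite: NeukirchANT1999, Ch. II (5.5)] -/
theorem one_sub_mul_le_pow_sub_mul {p : ℕ} (hp : 2 ≤ p) {e c : ℕ}
    (hc : p * e < p ^ (c + 1) * (p - 1)) (a : ℕ) :
    (1 : ℤ) - (c : ℤ) * (e : ℤ) ≤ (p : ℤ) ^ a - (e : ℤ) * (a : ℤ) := by
  have h := one_add_mul_le_pow_add_mul hp hc a
  have h' : ((1 + a * e : ℕ) : ℤ) ≤ ((p ^ a + c * e : ℕ) : ℤ) := by exact_mod_cast h
  push_cast at h'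
  linarith

variable {p : ℕ} [hp : Fact p.Prime]

/-- **Print's floor is maximal**: with `c := ⌊log(p·e/(p−1))/log p⌋` ([IUTchIV] Prop. 1.2, `b = c − 1/e`),
`p·e < p^{c+1}·(p−1)` for `e ≥ 1` — `LogRadius.lt_pow_floor_mul` (`e < p^c·(p−1)`) multiplied by `p`.
[cite: Mochizuki2012, IUTchIV Prop. 1.2 (i) p. 10–11] [claim: Mochizuki2012, status: disputed] -/
theorem floorLog_maximal {e : ℕ} (he : 1 ≤ e) :
    p * e < p ^ ((⌊Real.log ((p : ℝ) * e / ((p : ℝ) - 1)) / Real.log p⌋).toNat + 1) * (p - 1) := by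
  have h := lt_pow_floor_mul p he
  have hp1 : 1 ≤ p := hp.out.one_le
  have h' : (e : ℝ) < ((p ^ (⌊Real.log ((p : ℝ) * e / ((p : ℝ) - 1)) / Real.log p⌋).toNat * (p - 1) : ℕ) : ℝ) := by
    push_cast [Nat.cast_sub hp1]
    exact h
  have h'' : e < p ^ (⌊Real.log ((p : ℝ) * e / ((p : ℝ) - 1)) / Real.log p⌋).toNat * (p - 1) := by
    exact_mod_cast h'
  have hp0 : 0 < p := hp.out.pos
  calc p * e < p * (p ^ (⌊Real.log ((p : ℝ) * e / ((p : ℝ) - 1)) / Real.log p⌋).toNat * (p - 1)) :=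
        Nat.mul_lt_mul_of_pos_left h'' hp0
    _ = p ^ ((⌊Real.log ((p : ℝ) * e / ((p : ℝ) - 1)) / Real.log p⌋).toNat + 1) * (p - 1) := by
        rw [pow_succ]; ring

/-- **Every turning point is at most print's floor**: if `p^a·(p−1) < e` for all `a < a₀` then
`a₀ ≤ c = ⌊log(p·e/(p−1))/log p⌋` (else `p^c·(p−1) < e < p^c·(p−1)`).
[cite: Mochizuki2012, IUTchIV Prop. 1.2 (i) p. 10–11] [claim: Mochizuki2012, status: disputed] -/
theorem turning_le_floorLog {a₀ e : ℕ} (he : 1 ≤ e) (hlo : ∀ a < a₀, (p : ℤ) ^ a * ((p : ℤ) - 1) < e) :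
    a₀ ≤ (⌊Real.log ((p : ℝ) * e / ((p : ℝ) - 1)) / Real.log p⌋).toNat := by
  by_contra hcon
  push Not at hcon
  have h1 := hlo _ hcon
  have h2 := lt_pow_floor_mul p he
  have h1' : ((p : ℝ) ^ (⌊Real.log ((p : ℝ) * e / ((p : ℝ) - 1)) / Real.log p⌋).toNat * ((p : ℝ) - 1))
      < e := by exact_mod_cast h1
  linarith

/-- The same with the floor as an INTEGER: `(a₀ : ℤ) ≤ ⌊log(p·e/(p−1))/log p⌋`.
[cite: Mochizuki2012, IUTchIV Prop. 1.2 (i) p. 10–11] [claim: Mochizuki2012, status: disputed] -/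
theorem turning_le_floorLog_int {a₀ e : ℕ} (he : 1 ≤ e) (hlo : ∀ a < a₀, (p : ℤ) ^ a * ((p : ℤ) - 1) < e) :
    (a₀ : ℤ) ≤ ⌊Real.log ((p : ℝ) * e / ((p : ℝ) - 1)) / Real.log p⌋ := by
  have h := turning_le_floorLog (p := p) he hlo
  have h0 := floor_logRadius_nonneg p he
  have : ((a₀ : ℕ) : ℤ) ≤ (((⌊Real.log ((p : ℝ) * e / ((p : ℝ) - 1)) / Real.log p⌋).toNat : ℕ) : ℤ) := by
    exact_mod_cast h
  rwa [Int.toNat_of_nonneg h0] at this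

/-- **Off the cyclotomic indices print's floor IS the turning point, from above**: if the upper turning
inequality is strict, `e < p^{a₀}·(p−1)`, then `c = ⌊log(p·e/(p−1))/log p⌋ ≤ a₀`
(`p·e/(p−1) < p^{a₀+1}`). [cite: Mochizuki2012, IUTchIV Prop. 1.2 (i) p. 10–11] [claim: Mochizuki2012, status: disputed] -/
theorem floorLog_le_turning_of_lt {a₀ e : ℕ} (he : 1 ≤ e) (hhi : (e : ℤ) < (p : ℤ) ^ a₀ * ((p : ℤ) - 1)) :
    ⌊Real.log ((p : ℝ) * e / ((p : ℝ) - 1)) / Real.log p⌋ ≤ (a₀ : ℤ) := by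
  have hp1 : (1 : ℝ) < p := by exact_mod_cast hp.out.one_lt
  have hp0 : (0 : ℝ) < p := by linarith
  have hp1' : (0 : ℝ) < (p : ℝ) - 1 := by linarith
  have he' : (1 : ℝ) ≤ e := by exact_mod_cast he
  have hlogp : 0 < Real.log p := Real.log_pos hp1
  have hhi' : (e : ℝ) < (p : ℝ) ^ a₀ * ((p : ℝ) - 1) := by exact_mod_cast hhi
  set x : ℝ := (p : ℝ) * e / ((p : ℝ) - 1) with hx
  have hx0 : 0 < x := by rw [hx]; exact div_pos (by nlinarith) hp1'
  have hxlt : x < (p : ℝ) ^ (a₀ + 1) := by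
    rw [hx, div_lt_iff₀ hp1', pow_succ]
    nlinarith
  have hlog : Real.log x / Real.log p < (a₀ : ℝ) + 1 := by
    rw [div_lt_iff₀ hlogp]
    have := Real.log_lt_log hx0 hxlt
    rw [Real.log_pow] at this
    push_cast at this
    linarith
  have : ⌊Real.log x / Real.log p⌋ < (a₀ : ℤ) + 1 := by
    rw [Int.floor_lt]
    push_cast
    exact hlog
  omega

/-- **`c = a₀` off the cyclotomic indices**: for a STRICT turning point (`p^a·(p−1) < e` for `a < a₀`,
`e < p^{a₀}·(p−1)`) print's floor `⌊log(p·e/(p−1))/log p⌋` equals `a₀` (so `b + 1/e = a₀`, as recorded in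
`UnitLogMaxNorm`'s module doc). [cite: Mochizuki2012, IUTchIV Prop. 1.2 (i) p. 10–11] [claim: Mochizuki2012, status: disputed] -/
theorem floorLog_eq_turning_of_lt {a₀ e : ℕ} (he : 1 ≤ e) (hlo : ∀ a < a₀, (p : ℤ) ^ a * ((p : ℤ) - 1) < e)
    (hhi : (e : ℤ) < (p : ℤ) ^ a₀ * ((p : ℤ) - 1)) :
    ⌊Real.log ((p : ℝ) * e / ((p : ℝ) - 1)) / Real.log p⌋ = (a₀ : ℤ) :=
  le_antisymm (floorLog_le_turning_of_lt (p := p) he hhi) (turning_le_floorLog_int (p := p) he hlo)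

/-- **CONTAINER ≤ every exponent**: with print's `c = ⌊log(p·e/(p−1))/log p⌋` (an integer `≥ 0`),
`1 − c·e ≤ p^a − e·a` for EVERY `a` — §1's law at print's maximal `c`; no turning point needed.
[cite: Mochizuki2012, IUTchIV Prop. 1.2 (i) p. 10–11] [claim: Mochizuki2012, status: disputed] -/
theorem container_le_exponent {e : ℕ} (he : 1 ≤ e) (a : ℕ) :
    (1 : ℤ) - (⌊Real.log ((p : ℝ) * e / ((p : ℝ) - 1)) / Real.log p⌋) * (e : ℤ) ≤ (p : ℤ) ^ a - (e : ℤ) * (a : ℤ) := by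
  have h := one_sub_mul_le_pow_sub_mul hp.out.two_le (floorLog_maximal (p := p) he) a
  rwa [Int.toNat_of_nonneg (floor_logRadius_nonneg p he)] at h

/-- **The gap is exactly `p^{a₀} − 1` levels off the cyclotomic indices**: for a strict turning point,
`(p^{a₀} − e·a₀) − (1 − c·e) = p^{a₀} − 1` (`c = a₀`) — `UnitLogMaxNorm`'s remark «the exact radius is
`(p^{a₀} − 1)/e` `p`-levels smaller» as a theorem. [cite: Mochizuki2012, IUTchIV Prop. 1.2 (i) p. 10–11]
[claim: Mochizuki2012, status: disputed] -/
theorem envelope_sub_container_eq_of_lt {a₀ e : ℕ} (he : 1 ≤ e)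
    (hlo : ∀ a < a₀, (p : ℤ) ^ a * ((p : ℤ) - 1) < e) (hhi : (e : ℤ) < (p : ℤ) ^ a₀ * ((p : ℤ) - 1)) :
    ((p : ℤ) ^ a₀ - (e : ℤ) * (a₀ : ℤ)) - ((1 : ℤ) - (⌊Real.log ((p : ℝ) * e / ((p : ℝ) - 1)) / Real.log p⌋) * (e : ℤ))
      = (p : ℤ) ^ a₀ - 1 := by
  rw [floorLog_eq_turning_of_lt (p := p) he hlo hhi]
  ring

end Arith

/-! ### §2. Norms: the exact ball `{‖z‖ ≤ ‖ϖ‖^{p^{a₀} − e·a₀}}` lies in print's `p^{−b}·R` -/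

section Field

variable (p : ℕ) [hp : Fact p.Prime]
variable {K : Type*} [NontriviallyNormedField K] [instK : NormedAlgebra ℚ_[p] K] [IsUltrametricDist K]
  [ProperSpace K]
variable {ϖ : Kˣ} (hϖ : IsUniformizer ϖ)
include hϖ

/-- **ROOM INSIDE CONTAINER (norms).** For EVERY exponent `a` (in particular every turning point `a₀` of
`e = e(K/ℚ_p)`, where `‖ϖ‖^{p^{a₀} − e·a₀}` is the exact radius of `log_p(𝒪_K^×)`):
`‖ϖ‖^{p^{a} − e·a} ≤ p^{b}` with `b = logRadiusB p e = ⌊log(p·e/(p−1))/log p⌋ − 1/e` print's exponent of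
[IUTchIV] Prop. 1.2 (i) (`‖ϖ‖ = p^{−1/e}`, so this is `container_le_exponent` divided by `−e`).
[cite: Mochizuki2012, IUTchIV Prop. 1.2 (i) p. 10–11] [claim: Mochizuki2012, status: disputed] -/
theorem zpow_envelope_le_rpow_logRadiusB (a₀ : ℕ) :
    ‖(ϖ : K)‖ ^ ((p : ℤ) ^ a₀ - (absRamificationIdx p K : ℤ) * (a₀ : ℤ))
      ≤ (p : ℝ) ^ (logRadiusB p (absRamificationIdx p K)) := by
  have he := absRamificationIdx_pos p K
  have hcont := container_le_exponent (p := p) he a₀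
  have hp1 : (1 : ℝ) ≤ p := by exact_mod_cast hp.out.one_lt.le
  have hp0 : (0 : ℝ) ≤ p := by positivity
  have he0 : (0 : ℝ) < (absRamificationIdx p K : ℝ) := by exact_mod_cast he
  rw [norm_eq_rpow_of_isUniformizer p K hϖ, ← Real.rpow_intCast, ← Real.rpow_mul hp0]
  apply Real.rpow_le_rpow_of_exponent_le hp1
  unfold logRadiusB
  set c : ℤ := ⌊Real.log ((p : ℝ) * (absRamificationIdx p K : ℕ) / ((p : ℝ) - 1)) / Real.log p⌋ with hc
  set n : ℤ := (p : ℤ) ^ a₀ - (absRamificationIdx p K : ℤ) * (a₀ : ℤ) with hn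
  have hcast : (1 : ℝ) - (c : ℝ) * (absRamificationIdx p K : ℝ) ≤ (n : ℝ) := by
    have : (((1 : ℤ) - c * (absRamificationIdx p K : ℤ) : ℤ) : ℝ) ≤ ((n : ℤ) : ℝ) := by exact_mod_cast hcont
    push_cast at this
    exact this
  rw [show -(1 / (absRamificationIdx p K : ℝ)) * (n : ℝ) = (-(n : ℝ)) / (absRamificationIdx p K : ℝ) by ring,
    show (c : ℝ) - 1 / (absRamificationIdx p K : ℝ)
      = ((c : ℝ) * (absRamificationIdx p K : ℝ) - 1) / (absRamificationIdx p K : ℝ) by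
        field_simp]
  apply div_le_div_of_nonneg_right _ he0.le
  linarith

/-- **The exact ball lies in print's container**: `{‖z‖ ≤ ‖ϖ‖^{p^{a₀} − e·a₀}} ⊆ p^{−b}·R = pBall p K (−b)`,
`b = logRadiusB p e`, for every exponent `a₀` (turning point or not).
[cite: Mochizuki2012, IUTchIV Prop. 1.2 (i) p. 10–11] [claim: Mochizuki2012, status: disputed] -/
theorem closedBall_envelope_subset_pBall (a₀ : ℕ) :
    closedBall (0 : K) (‖(ϖ : K)‖ ^ ((p : ℤ) ^ a₀ - (absRamificationIdx p K : ℤ) * (a₀ : ℤ)))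
      ⊆ pBall p K (-logRadiusB p (absRamificationIdx p K)) := by
  intro z hz
  rw [mem_pBall_iff, neg_neg]
  rw [mem_closedBall_zero_iff] at hz
  exact hz.trans (zpow_envelope_le_rpow_logRadiusB p hϖ a₀)

/-- **`log_p(𝒪_K^×) ⊆` exact ball `⊆ p^{−b}·R`**: for every turning point `a₀` (`p^a·(p−1) < e` below,
`e ≤ p^{a₀}·(p−1)`), the upper inclusion of [IUTchIV] Prop. 1.2 (i) follows from the envelope bound
`logUnits_subset_closedBall_envelope` and `closedBall_envelope_subset_pBall` — print's container re-derived
THROUGH the exact radius. [cite: Mochizuki2012, IUTchIV Prop. 1.2 (i) p. 10–11] [claim: Mochizuki2012, status: disputed] -/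
theorem logUnits_subset_pBall_of_turning {a₀ : ℕ}
    (hlo : ∀ a < a₀, (p : ℤ) ^ a * ((p : ℤ) - 1) < absRamificationIdx p K)
    (hhi : (absRamificationIdx p K : ℤ) ≤ (p : ℤ) ^ a₀ * ((p : ℤ) - 1)) :
    logUnits K ⊆ pBall p K (-logRadiusB p (absRamificationIdx p K)) :=
  (logUnits_subset_closedBall_envelope p hϖ hlo hhi).trans (closedBall_envelope_subset_pBall p hϖ a₀)

omit hϖ in
/-- **Second proof of the upper half of `Prop12i`, via the exact radius** — regression `example`, not a
new declaration: its statement IS abc-iut-S1's landed `LogRadius.logUnits_subset_pBall_neg_logRadiusB`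
(`log_p(𝒪_K^×) ⊆ p^{−b}·R` for every `K`), here obtained from `logUnits_subset_pBall_of_turning` at a
turning point supplied by `exists_turning` and the uniformiser `unifChoice K`.
[cite: Mochizuki2012, IUTchIV Prop. 1.2 (i) p. 10–11] [claim: Mochizuki2012, status: disputed] -/
example : logUnits K ⊆ pBall p K (-logRadiusB p (absRamificationIdx p K)) := by
  obtain ⟨a₀, hlo, hhi⟩ := exists_turning (p := p) (absRamificationIdx p K)
  exact logUnits_subset_pBall_of_turning p (isUniformizer_unifChoice K) hlo hhi

omit hϖ in
/-- Pointwise form: `‖log_p u‖ ≤ p^{b}` for every `u : K` (`b = logRadiusB p e`), through the envelope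
bound `norm_unitLog_le_zpow_envelope` at any turning point. [cite: Mochizuki2012, IUTchIV Prop. 1.2 (i) p. 10–11]
[claim: Mochizuki2012, status: disputed] -/
theorem norm_unitLog_le_rpow_logRadiusB (u : K) :
    ‖unitLog u‖ ≤ (p : ℝ) ^ (logRadiusB p (absRamificationIdx p K)) := by
  obtain ⟨a₀, hlo, hhi⟩ := exists_turning (p := p) (absRamificationIdx p K)
  exact (norm_unitLog_le_zpow_envelope p (isUniformizer_unifChoice K) hlo hhi u).trans
    (zpow_envelope_le_rpow_logRadiusB p (isUniformizer_unifChoice K) a₀)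

end Field

/-! ### §3. The three worked places of the R-H bed (abc-iut-rh3-ref-1, 2026-08-27T03:09:31Z) -/

/-- `p = 5`, `e = 6420`: strict turning point `a₀ = 5` (`5^4·4 = 2500 < 6420 < 12500 = 5^5·4`), exact
exponent `5^5 − 5·6420 = −28975`, container `1 − 5·6420 = −32099`, gap `5^5 − 1 = 3124`.
[cite: NeukirchANT1999, Ch. II (5.5)] -/
example : (∀ a < 5, (5 : ℤ) ^ a * ((5 : ℤ) - 1) < (6420 : ℕ)) ∧ ((6420 : ℕ) : ℤ) < (5 : ℤ) ^ 5 * ((5 : ℤ) - 1) ∧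
    (5 : ℤ) ^ 5 - 6420 * 5 = -28975 ∧ (1 : ℤ) - 5 * 6420 = -32099 ∧
    (-28975 : ℤ) - (-32099) = 5 ^ 5 - 1 := by
  decide

/-- At `p = 5`, `e = 6420` print's floor `⌊log(5·6420/4)/log 5⌋` IS the turning point `5`
(`floorLog_eq_turning_of_lt`; no real-logarithm evaluation needed). [cite: Mochizuki2012, IUTchIV Prop. 1.2 (i) p. 10–11]
[claim: Mochizuki2012, status: disputed] -/
example : ⌊Real.log (((5 : ℕ) : ℝ) * ((6420 : ℕ) : ℝ) / (((5 : ℕ) : ℝ) - 1)) / Real.log ((5 : ℕ) : ℝ)⌋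
    = ((5 : ℕ) : ℤ) :=
  haveI : Fact (Nat.Prime 5) := ⟨by norm_num⟩
  floorLog_eq_turning_of_lt (p := 5) (a₀ := 5) (e := 6420) (by norm_num) (by decide) (by decide)

/-- `p = 3`, `e = 3210`: strict turning point `a₀ = 7` (`3^6·2 = 1458 < 3210 < 4374 = 3^7·2`), exact
exponent `3^7 − 7·3210 = −20283 ≥` container `1 − 7·3210 = −22469`. [cite: NeukirchANT1999, Ch. II (5.5)] -/
example : (∀ a < 7, (3 : ℤ) ^ a * ((3 : ℤ) - 1) < (3210 : ℕ)) ∧ ((3210 : ℕ) : ℤ) < (3 : ℤ) ^ 7 * ((3 : ℤ) - 1) ∧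
    (3 : ℤ) ^ 7 - 3210 * 7 = -20283 ∧ (1 : ℤ) - 7 * 3210 = -22469 := by
  decide

/-- At `p = 3`, `e = 3210` print's floor is `7`. [cite: Mochizuki2012, IUTchIV Prop. 1.2 (i) p. 10–11]
[claim: Mochizuki2012, status: disputed] -/
example : ⌊Real.log (((3 : ℕ) : ℝ) * ((3210 : ℕ) : ℝ) / (((3 : ℕ) : ℝ) - 1)) / Real.log ((3 : ℕ) : ℝ)⌋
    = ((7 : ℕ) : ℤ) :=
  haveI : Fact (Nat.Prime 3) := ⟨by norm_num⟩
  floorLog_eq_turning_of_lt (p := 3) (a₀ := 7) (e := 3210) (by norm_num) (by decide) (by decide)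

/-- `p = 7`, `e = 1605`: strict turning point `a₀ = 3` (`7^2·6 = 294 < 1605 < 2058 = 7^3·6`), exact
exponent `7^3 − 3·1605 = −4472` (the table's `R_out`) `≥` container `1 − 3·1605 = −4814`.
[cite: NeukirchANT1999, Ch. II (5.5)] -/
example : (∀ a < 3, (7 : ℤ) ^ a * ((7 : ℤ) - 1) < (1605 : ℕ)) ∧ ((1605 : ℕ) : ℤ) < (7 : ℤ) ^ 3 * ((7 : ℤ) - 1) ∧
    (7 : ℤ) ^ 3 - 1605 * 3 = -4472 ∧ (1 : ℤ) - 3 * 1605 = -4814 := by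
  decide

/-- At `p = 7`, `e = 1605` (the worked place FREY `p = 7`, `l = 107` of D-0121) print's floor is `3`.
[cite: Mochizuki2012, IUTchIV Prop. 1.2 (i) p. 10–11] [claim: Mochizuki2012, status: disputed] -/
example : ⌊Real.log (((7 : ℕ) : ℝ) * ((1605 : ℕ) : ℝ) / (((7 : ℕ) : ℝ) - 1)) / Real.log ((7 : ℕ) : ℝ)⌋
    = ((3 : ℕ) : ℤ) :=
  haveI : Fact (Nat.Prime 7) := ⟨by norm_num⟩
  floorLog_eq_turning_of_lt (p := 7) (a₀ := 3) (e := 1605) (by norm_num) (by decide) (by decide)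

end LogEnvelope

end Literature.IUT.LogVolume

end
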